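import Summits.CriticalPhenomena.PercolationContinuityZ3.Theorems.PercNearOneGluingNoHeavyQuantSymTripleTwoChain
import Summits.CriticalPhenomena.PercolationContinuityZ3.Theorems.PercNearOneGluingNoHeavyQuantDECAtTarget
import HarnessLib

/-!
# QUANT lane R8, T-DEC: SDEC IS CONVEX ALONG SAME-MEAN MIXTURES OF ONE SIBLING'S LAW — the extreme-point reduction of a forest to
# forests of gated blobs (arm-1 gen 55, architect)

builds on p205010 (kernel theorem, internal audit signed; external expert review pending)

Support file (`--supports stmt-CriticalPhenomena-4575`), QUANT lane seat prim-quant-arm-1 (gen 55, architect); memo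
`run/shared/lean/prim/quant/prim-quant-arm-1-g55/ARCH-G55.md` §0 (6).  Theorems only, standard axioms, no sorries.  The observation behind the
route design of `…QuantTripleTwoChain`, typed as a reusable k-general tool: `LawDec.DECAtT` is convex at a fixed target (`decAtT_mixture`,
`…QuantDECAtTarget`) and gating / convolution are affine in each factor, so
* **`sdec_of_mixture`**: a law that is a mixture of two laws WITH THE SAME MEAN, both SDEC at `x`, is SDEC at `x`;
* **`lconv_mix_right`**, **`sdec_lconv_of_mixture`**: the same for the convolution of a fixed law with a mixture (one sibling of a forest replaced by a
  same-mean mixture of two laws);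
* **`twoChain_mix_lo`**, **`twoChain_mix_hi`** (+ `_mul` product forms): every law on `{0,1,2}` — the gated 2-chain `gate_q(δ₁ ∗ gate_p δ₁) = (1−q, q(1−p), qp)` — is a
  same-mean mixture of the two extreme laws of its mean `m = q(1+p)`: the gated double blob `gate_{m/2} δ₂` and the gated relay `gate_m δ₁` (`m ≤ 1`)
  or the sure relay with an under-relay `{1: 2−m, 2: m−1}` (`m ≥ 1`).
Consequence (not restated as a theorem): SDEC of every forest at a floor follows from SDEC, at that floor, of the forests of gated blobs and sure
relays obtained by replacing each sibling by an extreme law of its mean; at tree-OK floors only the `m ≥ 1` extreme (the near-sure corner) escapes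
the slice lemmas `sdec_slice_relay` / `sdec_slice_blob_of_mixLaw'`.

HONEST STATUS.  Tool; `SiblingStep`, `GateStepN`, `LightResidDECOracle`, `FarTreeRow` OPEN; RATE class (log\*) / honest sentence of
`run/shared/lean/prim/quant/README.md` unchanged.  [this work].  That the extreme points of the laws on a finite set with prescribed mean are the
two-point laws is classical (moment geometry); nothing here is cited as a published result.  The gluing rows served
[cite: KozmaNitzan2024, Conjecture 3 (p. 15)]; product measure [cite: Grimmett1999, §1.3 p. 10].
-/

noncomputable section

open scoped BigOperators

namespace Summit.CriticalPhenomena.PercolationContinuityZ3.Theorems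
namespace Quant
namespace LawDec

open Finset

/-! ### Mixtures with a common mean -/

/-- gating is affine in the law. [this work] -/
theorem gate_mix (μ μ₁ μ₂ : ℕ → ℝ) (p q : ℝ) (hμ : ∀ h, μ h = p * μ₁ h + (1 - p) * μ₂ h) (h : ℕ) :
    gate μ q h = p * gate μ₁ q h + (1 - p) * gate μ₂ q h := by
  rw [gate_apply, gate_apply, gate_apply, hμ h]; ring

/-- **SDEC IS CONVEX ALONG SAME-MEAN MIXTURES**: if `μ = p·μ₁ + (1−p)·μ₂` on `{0..M}` with `μ₁`, `μ₂` of the same mean as `μ` and both SDEC at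
`x`, then `μ` is SDEC at `x`. [this work] -/
theorem sdec_of_mixture (x : ℝ) (M : ℕ) (μ μ₁ μ₂ : ℕ → ℝ) (p : ℝ) (hp0 : 0 ≤ p) (hp1 : p ≤ 1)
    (hμ : ∀ h, μ h = p * μ₁ h + (1 - p) * μ₂ h)
    (hm₁ : ∑ h ∈ Finset.range (M + 1), (h : ℝ) * μ₁ h = ∑ h ∈ Finset.range (M + 1), (h : ℝ) * μ h)
    (hm₂ : ∑ h ∈ Finset.range (M + 1), (h : ℝ) * μ₂ h = ∑ h ∈ Finset.range (M + 1), (h : ℝ) * μ h)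
    (h₁ : SDEC x M μ₁) (h₂ : SDEC x M μ₂) : SDEC x M μ := by
  intro q hq0 hq1 j hj
  have d₁ := h₁ q hq0 hq1 j hj
  have d₂ := h₂ q hq0 hq1 j hj
  rw [decAt_iff_decAtT, sum_mul_gate] at d₁ d₂ ⊢
  rw [hm₁] at d₁
  rw [hm₂] at d₂
  have e : gate μ q = fun h => p * gate μ₁ q h + (1 - p) * gate μ₂ q h := funext (gate_mix μ μ₁ μ₂ p q hμ)
  rw [e]
  exact decAtT_mixture p hp0 hp1 d₁ d₂

/-- convolution is affine in the right factor. [this work] -/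
theorem lconv_mix_right (M₁ M₂ : ℕ) (μ₁ ν ν₁ ν₂ : ℕ → ℝ) (p : ℝ) (hν : ∀ h, ν h = p * ν₁ h + (1 - p) * ν₂ h) (h : ℕ) :
    lconv M₁ M₂ μ₁ ν h = p * lconv M₁ M₂ μ₁ ν₁ h + (1 - p) * lconv M₁ M₂ μ₁ ν₂ h := by
  simp only [lconv, Finset.mul_sum, ← Finset.sum_add_distrib]
  refine Finset.sum_congr rfl fun i _ => Finset.sum_congr rfl fun k _ => ?_
  split_ifs
  · rw [hν k]; ring
  · ring

/-- **ONE SIBLING REPLACED BY A SAME-MEAN MIXTURE**: for probability laws `μ₁` on `{0..M₁}` and `ν = p·ν₁ + (1−p)·ν₂` on `{0..M₂}` with `ν₁`, `ν₂`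
of the same mean, if `μ₁ ∗ ν₁` and `μ₁ ∗ ν₂` are SDEC at `x` then so is `μ₁ ∗ ν`. [this work] -/
theorem sdec_lconv_of_mixture (x : ℝ) (M₁ M₂ : ℕ) (μ₁ ν ν₁ ν₂ : ℕ → ℝ) (p : ℝ) (hp0 : 0 ≤ p) (hp1 : p ≤ 1)
    (hν : ∀ h, ν h = p * ν₁ h + (1 - p) * ν₂ h)
    (hμ₁1 : ∑ h ∈ Finset.range (M₁ + 1), μ₁ h = 1)
    (hν₁1 : ∑ h ∈ Finset.range (M₂ + 1), ν₁ h = 1) (hν₂1 : ∑ h ∈ Finset.range (M₂ + 1), ν₂ h = 1)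
    (hmean : ∑ h ∈ Finset.range (M₂ + 1), (h : ℝ) * ν₁ h = ∑ h ∈ Finset.range (M₂ + 1), (h : ℝ) * ν₂ h)
    (h₁ : SDEC x (M₁ + M₂) (lconv M₁ M₂ μ₁ ν₁)) (h₂ : SDEC x (M₁ + M₂) (lconv M₁ M₂ μ₁ ν₂)) :
    SDEC x (M₁ + M₂) (lconv M₁ M₂ μ₁ ν) := by
  have hν1 : ∑ h ∈ Finset.range (M₂ + 1), ν h = 1 := by
    simp only [hν, Finset.sum_add_distrib, ← Finset.mul_sum, hν₁1, hν₂1]; ring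
  have hνmean : ∑ h ∈ Finset.range (M₂ + 1), (h : ℝ) * ν h = ∑ h ∈ Finset.range (M₂ + 1), (h : ℝ) * ν₁ h := by
    have e : ∀ h : ℕ, (h : ℝ) * ν h = p * ((h : ℝ) * ν₁ h) + (1 - p) * ((h : ℝ) * ν₂ h) := fun h => by rw [hν h]; ring
    simp only [e, Finset.sum_add_distrib, ← Finset.mul_sum, ← hmean]; ring
  refine sdec_of_mixture x (M₁ + M₂) _ _ _ p hp0 hp1 (lconv_mix_right M₁ M₂ μ₁ ν ν₁ ν₂ p hν) ?_ ?_ h₁ h₂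
  · rw [sum_mul_lconv M₁ M₂ μ₁ ν₁ hμ₁1 hν₁1, sum_mul_lconv M₁ M₂ μ₁ ν hμ₁1 hν1, hνmean]
  · rw [sum_mul_lconv M₁ M₂ μ₁ ν₂ hμ₁1 hν₂1, sum_mul_lconv M₁ M₂ μ₁ ν hμ₁1 hν1, hνmean, hmean]

/-! ### The extreme laws on `{0,1,2}` and the two chords -/

/-- the point mass `δ_K` -/
local notation3 "δ[" K "]" => (fun k : ℕ => if k = (K : ℕ) then (1 : ℝ) else 0)

/-- the 2-chain sub-forest law `ρ_p = δ₁ ∗ gate_p δ₁` -/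
local notation3 "ρ₂[" p "]" => lconv 1 1 (fun k : ℕ => if k = (1 : ℕ) then (1 : ℝ) else 0)
  (gate (fun k : ℕ => if k = (1 : ℕ) then (1 : ℝ) else 0) p)

/-- the near-sure extreme of mean `m ∈ [1,2]`: a sure relay with an under-relay of gate `m − 1`, `{1: 2−m, 2: m−1}`. [this work] -/
theorem lawC_apply (m : ℝ) (h : ℕ) :
    (ρ₂[m - 1]) h = (if h = 1 then 2 - m else 0) + (if h = 2 then m - 1 else 0) := by
  rw [tc_rho_apply]; split_ifs <;> ring

/-- **THE LOWER CHORD, product form**: `m·gate_q ρ_p = 2qp·gate_{m/2} δ₂ + q(1−p)·gate_m δ₁`, `m = q(1+p)` (a polynomial identity). [this work] -/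
theorem twoChain_mix_lo_mul (q p : ℝ) (h : ℕ) :
    q * (1 + p) * gate (ρ₂[p]) q h = 2 * q * p * gate δ[2] (q * (1 + p) / 2) h + q * (1 - p) * gate δ[1] (q * (1 + p)) h := by
  rw [gate_tc_apply, gate_apply, gate_apply]
  by_cases h0 : h = 0
  · subst h0; simp; ring
  by_cases h1 : h = 1
  · subst h1; simp; ring
  by_cases h2 : h = 2
  · subst h2; simp; ring
  simp [h0, h1, h2]

/-- **THE UPPER CHORD, product form**: `(2−m)·gate_q ρ_p = 2(1−q)·gate_{m/2} δ₂ + q(1−p)·{1: 2−m, 2: m−1}`, `m = q(1+p)`. [this work] -/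
theorem twoChain_mix_hi_mul (q p : ℝ) (h : ℕ) :
    (2 - q * (1 + p)) * gate (ρ₂[p]) q h
      = 2 * (1 - q) * gate δ[2] (q * (1 + p) / 2) h + q * (1 - p) * (ρ₂[q * (1 + p) - 1]) h := by
  rw [gate_tc_apply, gate_apply, lawC_apply]
  by_cases h0 : h = 0
  · subst h0; simp; ring
  by_cases h1 : h = 1
  · subst h1; simp; ring
  by_cases h2 : h = 2
  · subst h2; simp; ring
  simp [h0, h1, h2]

/-- **THE LOWER CHORD (`m = q(1+p) ≤ 1`)**: `gate_q ρ_p = (2qp/m)·gate_{m/2} δ₂ + (q(1−p)/m)·gate_m δ₁` — the gated 2-chain is a mixture of the gated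
double blob and the gated relay of the same mean. [this work] -/
theorem twoChain_mix_lo {q p : ℝ} (hq0 : 0 < q) (hp0 : 0 ≤ p) (h : ℕ) :
    gate (ρ₂[p]) q h = (2 * q * p / (q * (1 + p))) * gate δ[2] (q * (1 + p) / 2) h
      + (1 - 2 * q * p / (q * (1 + p))) * gate δ[1] (q * (1 + p)) h := by
  have hm : q * (1 + p) ≠ 0 := (mul_pos hq0 (by linarith)).ne'
  have k := twoChain_mix_lo_mul q p h
  have e : 1 - 2 * q * p / (q * (1 + p)) = q * (1 - p) / (q * (1 + p)) := by field_simp; ring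
  rw [e, div_mul_eq_mul_div, div_mul_eq_mul_div, ← add_div, eq_div_iff hm]
  linarith

/-- **THE UPPER CHORD (`1 ≤ m = q(1+p) < 2`)**: `gate_q ρ_p = (2(1−q)/(2−m))·gate_{m/2} δ₂ + (q(1−p)/(2−m))·{1: 2−m, 2: m−1}` — the gated 2-chain is a
mixture of the gated double blob and the near-sure extreme of the same mean. [this work] -/
theorem twoChain_mix_hi {q p : ℝ} (hq1 : q < 1) (hp0 : 0 ≤ p) (hp1 : p ≤ 1) (h : ℕ) :
    gate (ρ₂[p]) q h = (2 * (1 - q) / (2 - q * (1 + p))) * gate δ[2] (q * (1 + p) / 2) h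
      + (1 - 2 * (1 - q) / (2 - q * (1 + p))) * (ρ₂[q * (1 + p) - 1]) h := by
  have hm : 2 - q * (1 + p) ≠ 0 := by
    have h1p : 0 < 1 + p := by linarith
    have : q * (1 + p) < 1 * (1 + p) := mul_lt_mul_of_pos_right hq1 h1p
    intro hz; linarith
  have k := twoChain_mix_hi_mul q p h
  have e : 1 - 2 * (1 - q) / (2 - q * (1 + p)) = q * (1 - p) / (2 - q * (1 + p)) := by field_simp; ring
  rw [e, div_mul_eq_mul_div, div_mul_eq_mul_div, ← add_div, eq_div_iff hm]
  linarith

/-- the weights of the two chords are probabilities. [this work] -/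
theorem twoChain_mix_weights {q p : ℝ} (hq0 : 0 < q) (hq1 : q < 1) (hp0 : 0 ≤ p) (hp1 : p ≤ 1) :
    0 ≤ 2 * q * p / (q * (1 + p)) ∧ 2 * q * p / (q * (1 + p)) ≤ 1 ∧
      0 ≤ 2 * (1 - q) / (2 - q * (1 + p)) ∧ 2 * (1 - q) / (2 - q * (1 + p)) ≤ 1 := by
  have hm0 : 0 < q * (1 + p) := mul_pos hq0 (by linarith)
  have hm2 : 0 < 2 - q * (1 + p) := by
    have : q * (1 + p) < 1 * (1 + p) := mul_lt_mul_of_pos_right hq1 (by linarith)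
    linarith
  refine ⟨div_nonneg (by positivity) hm0.le, ?_, div_nonneg (by linarith) hm2.le, ?_⟩
  · rw [div_le_one hm0]; nlinarith
  · rw [div_le_one hm2]; nlinarith

/-- the three laws of a chord have the same mean `q(1+p)` (double blob, relay, near-sure extreme). [this work] -/
theorem twoChain_extreme_means (q p : ℝ) :
    (∑ h ∈ Finset.range (2 + 1), (h : ℝ) * gate δ[2] (q * (1 + p) / 2) h = q * (1 + p)) ∧
    (∑ h ∈ Finset.range (2 + 1), (h : ℝ) * gate δ[1] (q * (1 + p)) h = q * (1 + p)) ∧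
    (∑ h ∈ Finset.range (2 + 1), (h : ℝ) * (ρ₂[q * (1 + p) - 1]) h = q * (1 + p)) ∧
    (∑ h ∈ Finset.range (2 + 1), (h : ℝ) * gate (ρ₂[p]) q h = q * (1 + p)) := by
  refine ⟨?_, ?_, ?_, ?_⟩
  · simp [Finset.sum_range_succ, gate_apply]; ring
  · simp [Finset.sum_range_succ, gate_apply]
  · simp [Finset.sum_range_succ, lawC_apply]; ring
  · simp [Finset.sum_range_succ, gate_tc_apply]; ring

end LawDec
end Quant
end Summit.CriticalPhenomena.PercolationContinuityZ3.Theorems
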